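import Summits.CriticalPhenomena.PercolationContinuityZ3.Theses.PercHollowCells
import Summits.CriticalPhenomena.PercolationContinuityZ3.Theses.PercShatteringRace
import Literature.Probability.LatticeModels.HighDimPointwiseTriviality
import Literature.Probability.Percolation.RSW

/-!
# Line `birth` — registered skeleton (BC3) for the crux `QuantFreeBoxShattering`
# (stmt-CriticalPhenomena-5837, route `PercHollowCells`, rank 3)

Crux (fixed, by name): `PercHollowCells.QuantFreeBoxShattering` (QF) —
`∃ C, ∀ L ≥ 1, χᶠ_L := Σ_{x ∈ Λ_L} P_{p_c}(0 ↔ x inside Λ_L) ≤ C · L^{17/8}` (`Λ_L = box 3 L = [-L,L]³`, bond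
percolation on `ℤ³` at `p_c = criticalProbI 3`; `χᶠ_L = E_{p_c}|C_{Λ_L}(0)|` is the free-box susceptibility
of the CENTRE). Numerically `χᶠ_L ≍ L^{2-η} = L^{2.046}` (`η = -0.046`, arXiv:1302.0421 p.8): margin `0.079`.
QF is the exponent-`17/8` twin of stmt-5786 `PercShatteringRace.FreeSusceptibilityPowerSaving` (exponent `5/2`,
same sum verbatim): `QF → FreeSusceptibilityPowerSaving` is PROVED below (`freeSusceptibilityPowerSaving_of`),
so QF inherits that crux's STRATEGY-CENSUS (`Cruxes/FreeSusceptibilityPowerSaving/STRATEGY-CENSUS.md`, 2026-08-17)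
verbatim and a fortiori.

## THE LINE ("rooted in-box two-point currency, cut at the MESOSCOPIC radius `L^{15/16}`")

Write `τ_L(x) := P_{p_c}(0 ↔ x inside Λ_L)` for the rooted in-box two-point function and `‖x‖ = ‖x‖_∞`
(`Site.supNorm`). QF is the plain sum of `τ_L` over `Λ_L`; the skeleton bounds the summand POINTWISE in two
regimes separated by the sub-linear radius `r_L := L^{15/16}`:

* `stub_nearField` (OPEN, load-bearing) — DEEP targets `0 < ‖x‖ ≤ L^{15/16}`: the profile bound
  `τ_L(x) ≤ C · L^{1/4} / ‖x‖`. Summed with the tree's lattice sum `Σ_{v ∈ Λ_n} ‖v‖^{-1} ≤ 54 (n+1)²`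
  (`sum_box_inv_pow_supNorm_le`, `d = 3`, `n = ⌊L^{15/16}⌋`) it is the bulk part of QF:
  `L^{1/4} · L^{2·15/16} = L^{1/4 + 15/8} = L^{17/8}` — exactly on budget.
* `stub_farField` (OPEN) — MESOSCOPIC-TO-BOX-SCALE targets `L^{15/16} < ‖x‖ ≤ L`: the one-scale bound
  `τ_L(x) ≤ C · L^{-7/8}`. Summed by counting (`|Λ_L| ≤ 27 L³`) it is the rest: `27 L³ · L^{-7/8} = 27 L^{17/8}`.
* `QuantFreeBoxShattering_of : Sig.stub_nearField → Sig.stub_farField → QuantFreeBoxShattering` (hypotheses =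
  the name-keyed stub statements, definitionally the `stub_*` signatures; conclusion = the route decl BY NAME;
  proved, no `sorry`; wiring `example` = `QuantFreeBoxShattering_of stub_nearField stub_farField`): split `Σ_{Λ_L}` by
  the filter `‖x‖ ≤ L^{15/16}` (`Finset.sum_filter_add_sum_filter_not`), peel `x = 0` (`τ_L(0) ≤ 1 ≤ L^{17/8}`),
  bound the bulk by profile × lattice sum and the far region by counting; `C := 1 + 216·max C₁ 0 + 27·max C₂ 0`.

Truth margins against the numerics `τ(x) ≈ ‖x‖^{-(1+η)} = ‖x‖^{-0.954}` (and `τ_L ≤ τ`): near needs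
`‖x‖^{0.046} ≤ L^{1/4}` (room `L^{0.20}`); far needs `‖x‖^{-0.954} ≤ L^{-0.875}` for `‖x‖ > L^{15/16}`, i.e.
`0.954 · 15/16 = 0.894 ≥ 0.875` (room `L^{0.019}`; with `η ∈ [-0.06,-0.03]` the room is `[0.006, 0.034]`).

## WHY A SUB-LINEAR CUT (design note — the half-box cut collapses to ONE stub)

In-box connection is MONOTONE IN THE BOX (`openConnIn_mono`, RSW.lean: `Λ ⊆ Λ' ⇒ {0↔x in Λ} ⊆ {0↔x in Λ'}`),
so `τ_L(x) ≤ τ_{L'}(x)` for `L ≤ L'` (`tauIn_mono` below). Consequence, PROVED below as `halfBoxCut_collapse`: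
with the naive cut at `Λ_{⌊L/2⌋}` and the budget-forced near slack `L^{1/8}` (`L^{1/8}·L² = L^{17/8}`), the near
stub at scale `2L` already gives the far stub at scale `L` (`τ_L(x) ≤ τ_{2L}(x) ≤ C(2L)^{1/8}/‖x‖ ≤ C' L^{-7/8}` for
`‖x‖ > L/2`) — such a skeleton is one stub wearing two names (`line.shredded`). The transfer is killed exactly by
making the cut sub-linear: to reach a far target `‖x‖ = L^{a}` (`15/16 < a ≤ 1`) from the near stub one must go
to scale `L' ≥ ‖x‖^{16/15}`, paying `L'^{1/4}/‖x‖ ≥ ‖x‖^{4/15 - 1} = L^{-0.733a} ≫ L^{-7/8}`; summed over the far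
region the transferred bound is `≍ L^{2 + 4/15} = L^{2.27} ≫ L^{17/8}`. Conversely the far stub bounds `τ_L(x)`
only for `L < ‖x‖^{16/15}` and monotonicity runs the wrong way for larger boxes, so far ⇏ near and far ⇏ QF
(the uncovered core `‖x‖ ≤ L^{15/16}` has volume `≍ L^{45/16} ≫ L^{17/8}`), near ⇏ QF (uncovered shell of volume
`≍ L³`). The exponents `(15/16, 1/4)` are the simplest pair with: budget `1/4 + 2·15/16 = 17/8`; no transfer
(`1/4 > max(15/16 - 7/8, 15/128)`); both stubs numerically true.

## HONEST BOOKKEEPING (D-0027: "equivalence is not a defect; unexplained equivalence is")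

Both stubs are POINTWISE, hence stronger in profile than the (averaged) crux: QF implies neither (average ⇏
pointwise; the tree's pointwise-from-average tools need translation invariance, which `Λ_L` breaks), neither
alone implies QF (previous paragraph), jointly they give QF by the summation proved here. Neither follows from
the conjunct `θ(p_c) = 0` (quantitative rates), neither implies it as far as the tree knows: both are SCALE-TIED
(for fixed `x` only finitely many `L` are constrained: `L < ‖x‖^{16/15}` in far; in near the bound `C L^{1/4}/‖x‖`
tends to `∞` with `L`), so no `L`-uniform pointwise decay of `τ = lim_L τ_L` — the summit currency
(`θ(p_c)² ≤ τ(x)`, census §4 S⁺1) — can be extracted by monotone convergence. Both are CLOSED conditions in `p`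
failing at every `p > p_c` (deep in-box connections are `≥ c θ(p)²`), as the crux is (twin Disproof
`crux_false_at_p_one`): any proof uses `p ≤ p_c` sharply. The line does not claim an engine: per the twin
census (§0 D1–D2, §4 S⁺1) no rooted one-cluster UPPER bound with a rate is known at `p_c(ℤ³)`; the
restriction-sensitive tools in the tree are boundary tools (BGN, `BoxGateway`), which see targets within `o(L)`
of `∂Λ_L` — a foothold for the outer layers of `stub_farField` at best — and deep pairs (`stub_nearField`) are
the shared wall of 4445 ⟸ 4447 ⟸ 5786 ⟸ 5837.

DISPROOF USED: none exists for this item (`ledger crux ls stmt-CriticalPhenomena-5837`: no workfiles,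
2026-08-17; payload `disproof_path` absent). Twin `Cruxes/FreeSusceptibilityPowerSaving/Disproof.lean` (read,
not imported): honoured `crux_false_without_one_le` (guard `1 ≤ L` kept in both stubs), `crux_false_at_p_one`
(both stubs false at `p = 1`, where `τ_L ≡ 1` on `Λ_L`: the `p_c`-dependence sits in BOTH), `crux_exponent_floor`
(`e ≥ 1`; here `e = 17/8`), `crux_iff_uniform` / PERSIST√ (uniform-in-`p ≤ p_c` door numerically shut — not
used). Negatives index (`ledger negatives --problem CriticalPhenomena`): none on in-box two-point functions at
`p_c`. Dead lines of the twins (`bk-hyperscaling-tail-transfer`, `two-ghost-at-distance-bootstrap`,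
`delta-eleven-hutchcroft-hyperscaling` of 5786; `tightness-collapse-typical-kmax`,
`boundary-interior-split-fat-finite-clusters` of 4447) are not re-registered: no volume-tail, two-ghost,
`δ`-exponent, `K_max` or finite-cluster stub appears here.

Degenerate parameters: `L = 1`: `r_1 = 1`, near = the 26 sites with `‖x‖ = 1` (asks `τ_1(x) ≤ C`, true iff
`C ≥ p_c`-ish), far = ∅-or-nothing (`‖x‖ ≤ 1 = r_1` on `Λ_1`: vacuous); `x = 0` is excluded from `stub_nearField`
(`τ_L(0) = 1`; in Lean `‖0‖⁻¹ = 0⁻¹ = 0`) and peeled off in the composition; `⌊·⌋₊`, `Nat` casts and possibly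
negative constants (absorbed by `max · 0`) are handled explicitly.
-/

noncomputable section

namespace Summit.CriticalPhenomena.PercolationContinuityZ3.Cruxes.QuantFreeBoxShattering.Birth

open MeasureTheory Filter Topology
open Literature.Probability.Percolation Literature.Probability.LatticeModels
open Summit.CriticalPhenomena.PercolationContinuityZ3.Theses.PercHollowCells (QuantFreeBoxShattering)
open Summit.CriticalPhenomena.PercolationContinuityZ3.Theses.PercShatteringRace (FreeSusceptibilityPowerSaving)

/-! ## Objects of the line -/

/-- The critical bond percolation measure on `ℤ³`. -/
abbrev μc : Measure (BondConfig (Site 3)) := bondPercolation (zdGraph 3) (criticalProbI 3)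

/-- `τ_L(x) := P_{p_c}(0 ↔ x inside Λ_L)` — the rooted in-box two-point function of the free box `Λ_L`. -/
def tauIn (L : ℕ) (x : Site 3) : ℝ := μc.real (openConnIn (↑(box 3 L) : Set (Site 3)) 0 x)

/-- `χᶠ_L := Σ_{x ∈ Λ_L} τ_L(x) = E_{p_c}|C_{Λ_L}(0)|` — the crux's sequence (free-box susceptibility of the
centre). -/
def freeSusc (L : ℕ) : ℝ := ∑ x ∈ box 3 L, tauIn L x

/-- The crux is literally `∃ C, ∀ L ≥ 1, χᶠ_L ≤ C L^{17/8}`. -/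
theorem quantFreeBoxShattering_iff :
    QuantFreeBoxShattering ↔ ∃ C : ℝ, ∀ L : ℕ, 1 ≤ L → freeSusc L ≤ C * (L : ℝ) ^ ((17 : ℝ) / 8) :=
  Iff.rfl

/-- The near region `{x ∈ Λ_L : ‖x‖ ≤ L^{15/16}}` (contains `0`). -/
def near (L : ℕ) : Finset (Site 3) :=
  (box 3 L).filter fun x => (Site.supNorm x : ℝ) ≤ (L : ℝ) ^ ((15 : ℝ) / 16)

/-- The far region `{x ∈ Λ_L : ‖x‖ > L^{15/16}}`. -/
def far (L : ℕ) : Finset (Site 3) :=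
  (box 3 L).filter fun x => ¬ (Site.supNorm x : ℝ) ≤ (L : ℝ) ^ ((15 : ℝ) / 16)

theorem mem_near {L : ℕ} {x : Site 3} :
    x ∈ near L ↔ x ∈ box 3 L ∧ (Site.supNorm x : ℝ) ≤ (L : ℝ) ^ ((15 : ℝ) / 16) := Finset.mem_filter

theorem mem_far {L : ℕ} {x : Site 3} :
    x ∈ far L ↔ x ∈ box 3 L ∧ ¬ (Site.supNorm x : ℝ) ≤ (L : ℝ) ^ ((15 : ℝ) / 16) := Finset.mem_filter

theorem sum_near_add_sum_far (L : ℕ) (f : Site 3 → ℝ) :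
    ∑ x ∈ near L, f x + ∑ x ∈ far L, f x = ∑ x ∈ box 3 L, f x :=
  Finset.sum_filter_add_sum_filter_not _ _ _

/-! ## The two stub statements, name-keyed (`Sig.stub_*` — what `QuantFreeBoxShattering_of` takes by name) -/

namespace Sig

/-- Name-keyed statement of `stub_nearField` (profile bound for deep targets `0 < ‖x‖ ≤ L^{15/16}`). -/
def stub_nearField : Prop :=
  ∃ C : ℝ, ∀ L : ℕ, 1 ≤ L → ∀ x ∈ box 3 L, x ≠ 0 →
    (Site.supNorm x : ℝ) ≤ (L : ℝ) ^ ((15 : ℝ) / 16) →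
    (bondPercolation (zdGraph 3) (criticalProbI 3)).real (openConnIn (↑(box 3 L) : Set (Site 3)) 0 x)
      ≤ C * (L : ℝ) ^ ((1 : ℝ) / 4) / (Site.supNorm x : ℝ)

/-- Name-keyed statement of `stub_farField` (one-scale bound for targets `L^{15/16} < ‖x‖ ≤ L`). -/
def stub_farField : Prop :=
  ∃ C : ℝ, ∀ L : ℕ, 1 ≤ L → ∀ x ∈ box 3 L,
    (L : ℝ) ^ ((15 : ℝ) / 16) < (Site.supNorm x : ℝ) →
    (bondPercolation (zdGraph 3) (criticalProbI 3)).real (openConnIn (↑(box 3 L) : Set (Site 3)) 0 x)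
      ≤ C * (L : ℝ) ^ (-(7 : ℝ) / 8)

end Sig

/-- Readable (`τ_L`) form of `Sig.stub_nearField`. -/
theorem Sig.stub_nearField_iff : Sig.stub_nearField ↔
    ∃ C : ℝ, ∀ L : ℕ, 1 ≤ L → ∀ x ∈ box 3 L, x ≠ 0 →
      (Site.supNorm x : ℝ) ≤ (L : ℝ) ^ ((15 : ℝ) / 16) →
      tauIn L x ≤ C * (L : ℝ) ^ ((1 : ℝ) / 4) / (Site.supNorm x : ℝ) := Iff.rfl

/-- Readable (`τ_L`) form of `Sig.stub_farField`. -/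
theorem Sig.stub_farField_iff : Sig.stub_farField ↔
    ∃ C : ℝ, ∀ L : ℕ, 1 ≤ L → ∀ x ∈ box 3 L,
      (L : ℝ) ^ ((15 : ℝ) / 16) < (Site.supNorm x : ℝ) →
      tauIn L x ≤ C * (L : ℝ) ^ (-(7 : ℝ) / 8) := Iff.rfl

/-! ## The two registered stubs (the only `sorry`s of the file; statements spelled out, def-free,
definitionally `Sig.stub_nearField` / `Sig.stub_farField`) -/

/-- **stub 1 `stub_nearField` (registered; OPEN, load-bearing)** — profile bound for deep targets:
for `L ≥ 1`, `x ∈ Λ_L`, `x ≠ 0`, `‖x‖_∞ ≤ L^{15/16}`: `P_{p_c}(0 ↔ x inside Λ_L) ≤ C · L^{1/4} / ‖x‖_∞`.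
Why plausibly true: numerically `τ_L(x) ≤ τ(x) ≈ ‖x‖^{-(1+η)} = ‖x‖^{-0.954}` (arXiv:1302.0421: `2-η = 2.046`),
and `‖x‖^{-0.954} ≤ L^{1/4} ‖x‖^{-1}` iff `‖x‖^{0.046} ≤ L^{1/4}`, true with room `L^{0.2}`; the long-range
sibling's in-box average bound is a theorem (arXiv:2202.07634 p.5); mean field (`d > 6`) has `τ ≍ ‖x‖^{2-d}`.
Why it might fail: a ROOTED critical UPPER bound for DEEP pairs with a rate — the shared wall of 4445/4447/5786
(twin census §0 D1–D2: no rooted one-cluster upper bound with a rate is known at `p_c(ℤ³)`; boundary tools see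
only targets within `o(L)` of `∂Λ_L`); a chambered/weaving jump world (`θ(p_c) > 0`, in-box connections
suppressed only near the box scale) keeps `τ_L(x) ≥ c θ(p_c)²` for `‖x‖ ≤ L^{1-ε}`, contradicting the stub at
`‖x‖ ≫ L^{1/4}`. Scale-tied (bound `→ ∞` with `L` for fixed `x`): no full-space consequence.
Sources: Hutchcroft2022 (arXiv:2202.07634), arXiv:2103.17013, arXiv:1302.0421, twin census §4 S⁺1. -/
theorem stub_nearField :
    ∃ C : ℝ, ∀ L : ℕ, 1 ≤ L → ∀ x ∈ box 3 L, x ≠ 0 →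
      (Site.supNorm x : ℝ) ≤ (L : ℝ) ^ ((15 : ℝ) / 16) →
      (bondPercolation (zdGraph 3) (criticalProbI 3)).real (openConnIn (↑(box 3 L) : Set (Site 3)) 0 x)
        ≤ C * (L : ℝ) ^ ((1 : ℝ) / 4) / (Site.supNorm x : ℝ) := by
  sorry

/-- **stub 2 `stub_farField` (registered; OPEN)** — one-scale bound beyond the mesoscopic radius:
for `L ≥ 1`, `x ∈ Λ_L`, `‖x‖_∞ > L^{15/16}`: `P_{p_c}(0 ↔ x inside Λ_L) ≤ C · L^{-7/8}`.
Why plausibly true: `τ_L(x) ≤ τ(x) ≈ ‖x‖^{-0.954} < L^{-0.954·15/16} = L^{-0.894} ≤ L^{-0.875}` (room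
`L^{0.019}`); for the outer layers (targets within `o(L)` of a face) BGN-type boundary estimates
(BarskyGrimmettNewman1991; tree `BoxGateway.sum_gatewayPairs_le`) are the natural foothold and the free boundary
only helps. Why it might fail: for `L^{15/16} < ‖x‖ ≪ L` both endpoints are `≍ L`-deep, so the stub contains an
`η`-type exponent bound (`τ ≤ ‖x‖^{-14/15}` in kind) at one scale for deep pairs — in a jump world the
disjoint-ball factorisation `τ_L(x) ≤ π(‖x‖/4)·π^{Λ_L}_x(‖x‖/4)` has bulk factor `≥ θ(p_c)` (census §4 S⁺1); only
the scale-tying `L < ‖x‖^{16/15}` separates it from full-space decay `τ(x) ≤ C‖x‖^{-7/8·16/15}`, which gives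
`θ(p_c) = 0` outright; thin numerical room (`0.019`). NOT implied by `stub_nearField` (monotone transfer costs
`L^{2.27}` summed, see the design note). Sources: Hutchcroft2022 (arXiv:2202.07634 p.5), BarskyGrimmettNewman1991,
Grimmett1999, arXiv:1302.0421. -/
theorem stub_farField :
    ∃ C : ℝ, ∀ L : ℕ, 1 ≤ L → ∀ x ∈ box 3 L,
      (L : ℝ) ^ ((15 : ℝ) / 16) < (Site.supNorm x : ℝ) →
      (bondPercolation (zdGraph 3) (criticalProbI 3)).real (openConnIn (↑(box 3 L) : Set (Site 3)) 0 x)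
        ≤ C * (L : ℝ) ^ (-(7 : ℝ) / 8) := by
  sorry

/-! ## Proved plumbing -/

theorem tauIn_nonneg (L : ℕ) (x : Site 3) : 0 ≤ tauIn L x := measureReal_nonneg

theorem tauIn_le_one (L : ℕ) (x : Site 3) : tauIn L x ≤ 1 := measureReal_le_one

/-- In-box monotonicity: `L ≤ L' ⇒ τ_L(x) ≤ τ_{L'}(x)` (`openConnIn_mono`). -/
theorem tauIn_mono {L L' : ℕ} (h : L ≤ L') (x : Site 3) : tauIn L x ≤ tauIn L' x := by
  unfold tauIn
  exact measureReal_mono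
    (openConnIn_mono (Finset.coe_subset.2 (box_mono 3 h)) 0 x)

/-- Exponent bookkeeping, bulk: `L^{1/4} · L^{15/8} = L^{17/8}`. -/
theorem rpow_quarter_mul {L : ℝ} (hL : 0 < L) :
    L ^ ((1 : ℝ) / 4) * L ^ ((15 : ℝ) / 8) = L ^ ((17 : ℝ) / 8) := by
  rw [← Real.rpow_add hL]
  norm_num

/-- Exponent bookkeeping, threshold squared: `(L^{15/16})² = L^{15/8}`. -/
theorem thr_sq {L : ℝ} (hL : 0 ≤ L) :
    (L ^ ((15 : ℝ) / 16)) ^ 2 = L ^ ((15 : ℝ) / 8) := by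
  rw [← Real.rpow_natCast, ← Real.rpow_mul hL]
  norm_num

/-- Exponent bookkeeping, far region: `L³ · L^{-7/8} = L^{17/8}`. -/
theorem cube_mul_rpow_neg {L : ℝ} (hL : 0 < L) : L ^ 3 * L ^ (-(7 : ℝ) / 8) = L ^ ((17 : ℝ) / 8) := by
  rw [← Real.rpow_natCast L 3, ← Real.rpow_add hL]
  norm_num

/-- The tree's lattice sum at `d = 3`: `Σ_{v ∈ Λ_n} ‖v‖_∞^{-1} ≤ 54 (n+1)²` (the term `v = 0` is `0⁻¹ = 0`). -/
theorem sum_box_inv_supNorm_le (n : ℕ) :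
    ∑ v ∈ box 3 n, ((Site.supNorm v : ℝ))⁻¹ ≤ 54 * ((n : ℝ) + 1) ^ 2 := by
  have h := sum_box_inv_pow_supNorm_le (d := 3) le_rfl n
  have h' : ∑ v ∈ box 3 n, ((Site.supNorm v : ℝ))⁻¹ =
      ∑ v ∈ box 3 n, ((Site.supNorm v : ℝ) ^ (3 - 2))⁻¹ :=
    Finset.sum_congr rfl fun v _ => by norm_num
  rw [h']
  refine h.trans ?_
  norm_num

/-- `0` is near. -/
theorem zero_mem_near (L : ℕ) : (0 : Site 3) ∈ near L := by
  rw [mem_near]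
  refine ⟨zero_mem_box 3 L, ?_⟩
  rw [Site.supNorm_eq_zero_iff.2 rfl, Nat.cast_zero]
  exact Real.rpow_nonneg (Nat.cast_nonneg L) _

/-- The near region sits inside `Λ_{⌊L^{15/16}⌋}`. -/
theorem near_subset_box (L : ℕ) : near L ⊆ box 3 ⌊(L : ℝ) ^ ((15 : ℝ) / 16)⌋₊ := by
  intro x hx
  rw [mem_near] at hx
  exact mem_box_iff_supNorm_le.2 (Nat.le_floor hx.2)

/-- Counting the far region: `|far L| ≤ |Λ_L| = (2L+1)³ ≤ 27 L³` for `L ≥ 1`. -/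
theorem card_far_le {L : ℕ} (hL : 1 ≤ L) : ((far L).card : ℝ) ≤ 27 * (L : ℝ) ^ 3 := by
  have h1 : ((far L).card : ℝ) ≤ ((box 3 L).card : ℝ) := by
    exact_mod_cast Finset.card_le_card (Finset.filter_subset _ _)
  rw [card_box] at h1
  push_cast at h1
  have h2 : (1 : ℝ) ≤ L := by exact_mod_cast hL
  calc ((far L).card : ℝ) ≤ (2 * (L : ℝ) + 1) ^ 3 := h1
    _ ≤ (3 * (L : ℝ)) ^ 3 := by gcongr; linarith
    _ = 27 * (L : ℝ) ^ 3 := by ring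

/-- **Bulk part** (uses stub 1): `Σ_{x ∈ near L} τ_L(x) ≤ 1 + 216 · max C₁ 0 · L^{17/8}`. -/
theorem bulk_le {C₁ : ℝ}
    (h₁ : ∀ L : ℕ, 1 ≤ L → ∀ x ∈ box 3 L, x ≠ 0 → (Site.supNorm x : ℝ) ≤ (L : ℝ) ^ ((15 : ℝ) / 16) →
      tauIn L x ≤ C₁ * (L : ℝ) ^ ((1 : ℝ) / 4) / (Site.supNorm x : ℝ))
    {L : ℕ} (hL : 1 ≤ L) :
    ∑ x ∈ near L, tauIn L x ≤ 1 + 216 * max C₁ 0 * (L : ℝ) ^ ((17 : ℝ) / 8) := by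
  have hL0 : (0 : ℝ) < L := by exact_mod_cast hL
  rw [← Finset.add_sum_erase _ _ (zero_mem_near L)]
  -- the punctured near region, bounded pointwise by the profile
  have hrest : ∑ x ∈ (near L).erase 0, tauIn L x ≤
      max C₁ 0 * (L : ℝ) ^ ((1 : ℝ) / 4) *
        (54 * (((⌊(L : ℝ) ^ ((15 : ℝ) / 16)⌋₊ : ℕ) : ℝ) + 1) ^ 2) := by
    calc ∑ x ∈ (near L).erase 0, tauIn L x
        ≤ ∑ x ∈ (near L).erase 0,
            max C₁ 0 * (L : ℝ) ^ ((1 : ℝ) / 4) * ((Site.supNorm x : ℝ))⁻¹ := by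
          refine Finset.sum_le_sum fun x hx => ?_
          rw [Finset.mem_erase] at hx
          have hxN := mem_near.1 hx.2
          calc tauIn L x ≤ C₁ * (L : ℝ) ^ ((1 : ℝ) / 4) / (Site.supNorm x : ℝ) :=
                h₁ L hL x hxN.1 hx.1 hxN.2
            _ = C₁ * ((L : ℝ) ^ ((1 : ℝ) / 4) * ((Site.supNorm x : ℝ))⁻¹) := by ring
            _ ≤ max C₁ 0 * ((L : ℝ) ^ ((1 : ℝ) / 4) * ((Site.supNorm x : ℝ))⁻¹) :=
                mul_le_mul_of_nonneg_right (le_max_left _ _) (by positivity)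
            _ = max C₁ 0 * (L : ℝ) ^ ((1 : ℝ) / 4) * ((Site.supNorm x : ℝ))⁻¹ := by ring
      _ ≤ ∑ x ∈ box 3 ⌊(L : ℝ) ^ ((15 : ℝ) / 16)⌋₊,
            max C₁ 0 * (L : ℝ) ^ ((1 : ℝ) / 4) * ((Site.supNorm x : ℝ))⁻¹ :=
          Finset.sum_le_sum_of_subset_of_nonneg ((Finset.erase_subset _ _).trans (near_subset_box L))
            (fun x _ _ => by positivity)
      _ = max C₁ 0 * (L : ℝ) ^ ((1 : ℝ) / 4) *
            ∑ x ∈ box 3 ⌊(L : ℝ) ^ ((15 : ℝ) / 16)⌋₊, ((Site.supNorm x : ℝ))⁻¹ := by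
          rw [Finset.mul_sum]
      _ ≤ max C₁ 0 * (L : ℝ) ^ ((1 : ℝ) / 4) *
            (54 * (((⌊(L : ℝ) ^ ((15 : ℝ) / 16)⌋₊ : ℕ) : ℝ) + 1) ^ 2) := by
          gcongr
          exact sum_box_inv_supNorm_le _
  -- `(⌊L^{15/16}⌋ + 1)² ≤ 4 L^{15/8}` and `L^{1/4} L^{15/8} = L^{17/8}`
  have hsq : (((⌊(L : ℝ) ^ ((15 : ℝ) / 16)⌋₊ : ℕ) : ℝ) + 1) ^ 2 ≤ 4 * (L : ℝ) ^ ((15 : ℝ) / 8) := by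
    have hfl : ((⌊(L : ℝ) ^ ((15 : ℝ) / 16)⌋₊ : ℕ) : ℝ) ≤ (L : ℝ) ^ ((15 : ℝ) / 16) :=
      Nat.floor_le (Real.rpow_nonneg hL0.le _)
    have h1 : (1 : ℝ) ≤ (L : ℝ) ^ ((15 : ℝ) / 16) :=
      Real.one_le_rpow (by exact_mod_cast hL) (by norm_num)
    calc (((⌊(L : ℝ) ^ ((15 : ℝ) / 16)⌋₊ : ℕ) : ℝ) + 1) ^ 2
        ≤ (2 * (L : ℝ) ^ ((15 : ℝ) / 16)) ^ 2 := by
          gcongr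
          linarith
      _ = 4 * ((L : ℝ) ^ ((15 : ℝ) / 16)) ^ 2 := by ring
      _ = 4 * (L : ℝ) ^ ((15 : ℝ) / 8) := by rw [thr_sq hL0.le]
  calc tauIn L 0 + ∑ x ∈ (near L).erase 0, tauIn L x
      ≤ 1 + max C₁ 0 * (L : ℝ) ^ ((1 : ℝ) / 4) *
          (54 * (((⌊(L : ℝ) ^ ((15 : ℝ) / 16)⌋₊ : ℕ) : ℝ) + 1) ^ 2) :=
        add_le_add (tauIn_le_one L 0) hrest
    _ ≤ 1 + max C₁ 0 * (L : ℝ) ^ ((1 : ℝ) / 4) * (54 * (4 * (L : ℝ) ^ ((15 : ℝ) / 8))) := by gcongr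
    _ = 1 + 216 * max C₁ 0 * ((L : ℝ) ^ ((1 : ℝ) / 4) * (L : ℝ) ^ ((15 : ℝ) / 8)) := by ring
    _ = 1 + 216 * max C₁ 0 * (L : ℝ) ^ ((17 : ℝ) / 8) := by rw [rpow_quarter_mul hL0]

/-- **Far part** (uses stub 2): `Σ_{x ∈ far L} τ_L(x) ≤ 27 · max C₂ 0 · L^{17/8}`. -/
theorem far_le {C₂ : ℝ}
    (h₂ : ∀ L : ℕ, 1 ≤ L → ∀ x ∈ box 3 L, (L : ℝ) ^ ((15 : ℝ) / 16) < (Site.supNorm x : ℝ) →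
      tauIn L x ≤ C₂ * (L : ℝ) ^ (-(7 : ℝ) / 8))
    {L : ℕ} (hL : 1 ≤ L) :
    ∑ x ∈ far L, tauIn L x ≤ 27 * max C₂ 0 * (L : ℝ) ^ ((17 : ℝ) / 8) := by
  have hL0 : (0 : ℝ) < L := by exact_mod_cast hL
  calc ∑ x ∈ far L, tauIn L x
      ≤ ∑ x ∈ far L, max C₂ 0 * (L : ℝ) ^ (-(7 : ℝ) / 8) := by
        refine Finset.sum_le_sum fun x hx => ?_
        rw [mem_far] at hx
        exact (h₂ L hL x hx.1 (not_le.1 hx.2)).trans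
          (mul_le_mul_of_nonneg_right (le_max_left _ _) (by positivity))
    _ = ((far L).card : ℝ) * (max C₂ 0 * (L : ℝ) ^ (-(7 : ℝ) / 8)) := by
        rw [Finset.sum_const, nsmul_eq_mul]
    _ ≤ (27 * (L : ℝ) ^ 3) * (max C₂ 0 * (L : ℝ) ^ (-(7 : ℝ) / 8)) :=
        mul_le_mul_of_nonneg_right (card_far_le hL) (by positivity)
    _ = 27 * max C₂ 0 * ((L : ℝ) ^ 3 * (L : ℝ) ^ (-(7 : ℝ) / 8)) := by ring
    _ = 27 * max C₂ 0 * (L : ℝ) ^ ((17 : ℝ) / 8) := by rw [cube_mul_rpow_neg hL0]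

/-! ## The composition (proved): the two stubs imply the crux BY NAME -/

/-- **`QuantFreeBoxShattering` from the two registered stubs** (hypotheses = the name-keyed stub statements
`Sig.stub_nearField`, `Sig.stub_farField` — definitionally the signatures of the sorried `stub_*` theorems;
conclusion = the route decl `PercHollowCells.QuantFreeBoxShattering` by name; no `sorry`).
`χᶠ_L = Σ_{near} τ_L + Σ_{far} τ_L ≤ (1 + 216·max C₁ 0·L^{17/8}) + 27·max C₂ 0·L^{17/8}
≤ (1 + 216·max C₁ 0 + 27·max C₂ 0)·L^{17/8}` (as `1 ≤ L^{17/8}`). -/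
theorem QuantFreeBoxShattering_of (hN : Sig.stub_nearField) (hF : Sig.stub_farField) :
    Summit.CriticalPhenomena.PercolationContinuityZ3.Theses.PercHollowCells.QuantFreeBoxShattering := by
  rw [Sig.stub_nearField_iff] at hN
  rw [Sig.stub_farField_iff] at hF
  obtain ⟨C₁, h₁⟩ := hN
  obtain ⟨C₂, h₂⟩ := hF
  rw [quantFreeBoxShattering_iff]
  refine ⟨1 + 216 * max C₁ 0 + 27 * max C₂ 0, fun L hL => ?_⟩
  have hone : (1 : ℝ) ≤ (L : ℝ) ^ ((17 : ℝ) / 8) :=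
    Real.one_le_rpow (by exact_mod_cast hL) (by norm_num)
  unfold freeSusc
  rw [← sum_near_add_sum_far L (tauIn L)]
  calc ∑ x ∈ near L, tauIn L x + ∑ x ∈ far L, tauIn L x
      ≤ (1 + 216 * max C₁ 0 * (L : ℝ) ^ ((17 : ℝ) / 8)) + 27 * max C₂ 0 * (L : ℝ) ^ ((17 : ℝ) / 8) :=
        add_le_add (bulk_le h₁ hL) (far_le h₂ hL)
    _ ≤ ((L : ℝ) ^ ((17 : ℝ) / 8) + 216 * max C₁ 0 * (L : ℝ) ^ ((17 : ℝ) / 8)) +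
          27 * max C₂ 0 * (L : ℝ) ^ ((17 : ℝ) / 8) := by
        gcongr
    _ = (1 + 216 * max C₁ 0 + 27 * max C₂ 0) * (L : ℝ) ^ ((17 : ℝ) / 8) := by ring

/-- Wiring check: the registered stubs feed `QuantFreeBoxShattering_of` exactly as stated — the skeleton IS
the crux proof once the two sorries go. -/
example : Summit.CriticalPhenomena.PercolationContinuityZ3.Theses.PercHollowCells.QuantFreeBoxShattering :=
  QuantFreeBoxShattering_of stub_nearField stub_farField

/-! ## Design note, proved: the naive half-box cut collapses to one stub -/

/-- With the cut at `Λ_{⌊L/2⌋}` and near slack `L^{1/8}`, the near stub (at scale `2L`) already implies the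
matching far stub (at scale `L`) by in-box monotonicity — which is why this line cuts at `L^{15/16}` instead. -/
theorem halfBoxCut_collapse
    (hN : ∃ C : ℝ, ∀ L : ℕ, 1 ≤ L → ∀ x ∈ box 3 (L / 2), x ≠ 0 →
      tauIn L x ≤ C * (L : ℝ) ^ ((1 : ℝ) / 8) / (Site.supNorm x : ℝ)) :
    ∃ C : ℝ, ∀ L : ℕ, 1 ≤ L → ∀ x ∈ box 3 L, x ∉ box 3 (L / 2) →
      tauIn L x ≤ C * (L : ℝ) ^ (-(7 : ℝ) / 8) := by
  obtain ⟨C, hC⟩ := hN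
  refine ⟨max C 0 * (2 : ℝ) ^ ((1 : ℝ) / 8) * 2, fun L hL x hx hx' => ?_⟩
  have hL0 : (0 : ℝ) < L := by exact_mod_cast hL
  have hx0 : x ≠ 0 := by
    rintro rfl
    exact hx' (zero_mem_box 3 (L / 2))
  have hxL : x ∈ box 3 (2 * L / 2) := by
    rw [Nat.mul_div_cancel_left L two_pos]
    exact hx
  -- `‖x‖ > L/2`, i.e. `L < 2‖x‖`
  have hs : (L : ℝ) < 2 * (Site.supNorm x : ℝ) := by
    have h1 : ¬ Site.supNorm x ≤ L / 2 := fun h => hx' (mem_box_iff_supNorm_le.2 h)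
    have h2 : L < Site.supNorm x * 2 := (Nat.div_lt_iff_lt_mul two_pos).1 (not_le.1 h1)
    have h3 : (L : ℝ) < (Site.supNorm x : ℝ) * 2 := by exact_mod_cast h2
    linarith
  have hspos : (0 : ℝ) < (Site.supNorm x : ℝ) := by
    have : (0 : ℝ) ≤ L := hL0.le
    linarith
  -- monotone transfer to scale `2L`, then the near stub there
  have hmono : tauIn L x ≤ tauIn (2 * L) x := tauIn_mono (by omega) x
  have happ : tauIn (2 * L) x ≤ C * ((2 * L : ℕ) : ℝ) ^ ((1 : ℝ) / 8) / (Site.supNorm x : ℝ) :=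
    hC (2 * L) (by omega) x hxL hx0
  have hcast : ((2 * L : ℕ) : ℝ) = 2 * (L : ℝ) := by push_cast; ring
  rw [hcast, Real.mul_rpow (by norm_num) hL0.le] at happ
  -- `1/‖x‖ ≤ 2/L`
  have hinv : ((Site.supNorm x : ℝ))⁻¹ ≤ 2 / (L : ℝ) := by
    rw [inv_eq_one_div, div_le_div_iff₀ hspos hL0]
    linarith
  -- `L^{1/8} / L = L^{-7/8}`
  have hexp : (L : ℝ) ^ ((1 : ℝ) / 8) / (L : ℝ) = (L : ℝ) ^ (-(7 : ℝ) / 8) := by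
    rw [div_eq_mul_inv, ← Real.rpow_neg_one (L : ℝ), ← Real.rpow_add hL0]
    norm_num
  calc tauIn L x ≤ tauIn (2 * L) x := hmono
    _ ≤ C * ((2 : ℝ) ^ ((1 : ℝ) / 8) * (L : ℝ) ^ ((1 : ℝ) / 8)) / (Site.supNorm x : ℝ) := happ
    _ = C * ((2 : ℝ) ^ ((1 : ℝ) / 8) * (L : ℝ) ^ ((1 : ℝ) / 8) * ((Site.supNorm x : ℝ))⁻¹) := by ring
    _ ≤ max C 0 * ((2 : ℝ) ^ ((1 : ℝ) / 8) * (L : ℝ) ^ ((1 : ℝ) / 8) * ((Site.supNorm x : ℝ))⁻¹) :=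
        mul_le_mul_of_nonneg_right (le_max_left _ _) (by positivity)
    _ ≤ max C 0 * ((2 : ℝ) ^ ((1 : ℝ) / 8) * (L : ℝ) ^ ((1 : ℝ) / 8) * (2 / (L : ℝ))) := by
        gcongr
    _ = max C 0 * (2 : ℝ) ^ ((1 : ℝ) / 8) * 2 * ((L : ℝ) ^ ((1 : ℝ) / 8) / (L : ℝ)) := by ring
    _ = max C 0 * (2 : ℝ) ^ ((1 : ℝ) / 8) * 2 * (L : ℝ) ^ (-(7 : ℝ) / 8) := by rw [hexp]

/-! ## Honest piece: the crux implies its exponent-`5/2` twin (stmt-CriticalPhenomena-5786) -/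

/-- `QuantFreeBoxShattering → PercShatteringRace.FreeSusceptibilityPowerSaving` (same sum, `L^{17/8} ≤ L^{5/2}`
for `L ≥ 1`): every wall recorded for stmt-5786 is a wall for this crux. -/
theorem freeSusceptibilityPowerSaving_of (hQ : QuantFreeBoxShattering) : FreeSusceptibilityPowerSaving := by
  obtain ⟨C, hC⟩ := hQ
  refine ⟨max C 0, fun R hR => ?_⟩
  have hR1 : (1 : ℝ) ≤ R := by exact_mod_cast hR
  calc ∑ y ∈ box 3 R, (bondPercolation (zdGraph 3) (criticalProbI 3)).real
          (openConnIn (↑(box 3 R) : Set (Site 3)) 0 y)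
      ≤ C * (R : ℝ) ^ ((17 : ℝ) / 8) := hC R hR
    _ ≤ max C 0 * (R : ℝ) ^ ((17 : ℝ) / 8) :=
        mul_le_mul_of_nonneg_right (le_max_left _ _) (by positivity)
    _ ≤ max C 0 * (R : ℝ) ^ ((5 : ℝ) / 2) :=
        mul_le_mul_of_nonneg_left
          (Real.rpow_le_rpow_of_exponent_le hR1 (by norm_num)) (le_max_right _ _)

end Summit.CriticalPhenomena.PercolationContinuityZ3.Cruxes.QuantFreeBoxShattering.Birth

end
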